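import Summits.HodgeConjecture.HodgeConjecture.Theses.HeckePrymWeil
import Summits.HodgeConjecture.HodgeConjecture.Theorems.HeckePrymWeilHyperbolicEightfoldsSqrtMinus7LerayFact
import Summits.HodgeConjecture.HodgeConjecture.Theorems.HeckePrymWeilHeckePrymAnchorsOfStubs
import Summits.HodgeConjecture.HodgeConjecture.Theorems.HeckePrymWeilHodgeWeilOfWeilTransport
import Summits.HodgeConjecture.HodgeConjecture.Theorems.HeckePrymWeilHyperbolicEightfoldsSqrtMinus7HypAnchor
import Literature.AlgebraicGeometry.HodgeTheory.WeilFamilyReachSystem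
import Literature.AlgebraicGeometry.HodgeTheory.WeilClassesIsogenyDescent
import Literature.AlgebraicGeometry.HodgeTheory.WeilClassesRationalPlane
import Literature.AlgebraicGeometry.HodgeTheory.AbelianVarietyEndomorphismsHOne
import Literature.AlgebraicGeometry.HodgeTheory.FermatHypersurfaceReduction
import Literature.AlgebraicGeometry.Motives.SegreHyperplaneClass
import HarnessLib

/-!
# `HeckePrymWeil.HyperbolicEightfoldsSqrtMinus7` from hyperbolic reach (line `Sketch`, skeleton v10)

Supports the crux item stmt-HodgeConjecture-14642 (`HeckePrymWeil.HyperbolicEightfoldsSqrtMinus7`, route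
route-HodgeConjecture-HeckePrymWeil): the composition, tightness and cross-links of skeleton v10 of line `Sketch`
("hyperbolic reach"), sorry-free.  The anchor is the unconditional `hypAnchor`
(`Theorems/HeckePrymWeilHyperbolicEightfoldsSqrtMinus7HypAnchor`, landed).

* `hyperbolicEightfoldsSqrtMinus7_of_hypFamilyFact_of_hypWeilTransport` — the crux from the named fact
  `HodgeTheory.weilFamily_hyperbolic_weilSystem_reach` (Deligne's polarized Weil family over the HYPERBOLIC component
  through the crux's own hyperbolic `(A, φ, e, a)` — hyperbolicity LOAD-BEARING — with its flat Weil sub-local system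
  and the reach of every hyperbolic target up to a `K`-isogeny from a fibre) and the hyperbolic Weil transport HT
  (variational Hodge for flat Weil classes towards a HYPERBOLIC fibre, dimension 8; OPEN), spelled out as a
  hypothesis.  CONDITIONAL on exactly these two.  Ingredients: `stub_upgrade`, `stub_rationalAlongSection`,
  `stub_isogenyTransfer`, `owf_isoTransport` (landed, `HeckePrymWeilLine`), the W-engine
  `TensorAnchor.stub_globalClassEngine` (landed, unconditional), `hypAnchor` (landed).
* `hyperbolicEightfoldsSqrtMinus7_at_anchor` — UNCONDITIONAL instance: the crux's conclusion holds for every class of the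
  typed Weil plane of the anchor `hypAnchor` (joint satisfiability of the hypotheses + the conclusion on the anchor family).
* `hypWeilTransport_of_hyperbolicEightfoldsSqrtMinus7` — TIGHTNESS: the crux implies HT; hence, given the named
  fact, crux ⟺ HT (`hyperbolicEightfoldsSqrtMinus7_iff_hypWeilTransport`): HT is exactly the open content of the
  crux along this line (= Markman 2025 Thm 1.5.1 one dimension up, on the hyperbolic component).
* `hypWeilTransport_of_weilVariationalHodge` — HT ⇐ the route crux `WeilVariationalHodge` (stmt-HodgeConjecture-14497)
  at `(7, 4)`; `hyperbolicEightfoldsSqrtMinus7_of_hypFamilyFact_of_weilVariationalHodge` — crux ⇐ named fact ∧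
  `WeilVariationalHodge`.

## References
* [Deligne1982HodgeCycles] P. Deligne (notes by J. S. Milne), Hodge cycles on abelian varieties, LNM 900 (1982),
  Prop. 4.4, Lemma 4.5, proof of Thm. 4.8 (pp. 47–52), Remark 4.10.
* [vanGeemen1994HodgeAV] B. van Geemen, An introduction to the Hodge conjecture for abelian varieties, LNM 1594
  (1994), 4.9, Lemma 5.2, 5.3–5.11.
* [Markman2025SecantWeil] E. Markman, arXiv:2502.03415, Thm. 1.5.1 and §1.2.
* [Markman2025SurveySecant] E. Markman, survey, §11.5 Step 1.
* [Grothendieck1966] A. Grothendieck, On the de Rham cohomology of algebraic varieties, footnote 13.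
-/

noncomputable section

set_option linter.dupNamespace false

open CategoryTheory MonoidalCategory CartesianMonoidalCategory AlgebraicGeometry
open Literature.AlgebraicGeometry Literature.AlgebraicGeometry.Motives
  Literature.AlgebraicGeometry.HodgeTheory Literature.AlgebraicTopology.SingularHomology
open Summit.HodgeConjecture.HodgeConjecture.Theorems.HeckePrymWeilLine
  (stub_upgrade stub_rationalAlongSection stub_isogenyTransfer owf_isoTransport)

namespace Summit.HodgeConjecture.HodgeConjecture.Theorems.HyperbolicEightfoldsSqrtMinus7.HyperbolicReach

/-! ### The composition (concludes the crux BY NAME, conditional on the named fact and HT) -/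

/-- **`HyperbolicEightfoldsSqrtMinus7` from Deligne's hyperbolic Weil family (named fact) and the hyperbolic Weil
transport HT** — hyperbolicity LOAD-BEARING; CONDITIONAL on exactly these two hypotheses.  Given the hyperbolic
`(A, φ, e, a)` and a rational `(4,4)` class `c` of the typed Weil plane: `c = 0` is algebraic; otherwise `c`
lies in the strong Weil plane (`stub_upgrade`, landed); Deligne's hyperbolic family THROUGH `A` (the named fact
`weilFamily_hyperbolic_weilSystem_reach`, the crux's hyperbolicity consumed here) carries `c` as a flat fibrewise-Hodge Weil section `σ`, globalised to one
class `W` (W-engine, landed unconditional), rational along the section (landed); the reach clause puts the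
unconditional anchor `T` (`hypAnchor`) `K`-isogenous to a fibre `Y_s`, whose strong Weil plane is then
algebraic (`stub_isogenyTransfer`, landed), so `W|_s` is algebraic; HT transports to `s₀`, whose chart is
`A` itself, hyperbolic; return along `e' : A ≅ 𝒳_{s₀}`. [cite: Deligne1982HodgeCycles, proof of Thm. 4.8]
[cite: vanGeemen1994HodgeAV, 5.2–5.11] [cite: Markman2025SurveySecant, §11.5 Step 1] -/
theorem hyperbolicEightfoldsSqrtMinus7_of_hypFamilyFact_of_hypWeilTransport
    (hHF : weilFamily_hyperbolic_weilSystem_reach)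
    (hHT :
      ∀ ⦃𝒳 S : SchemeOver ℂ⦄ (f : 𝒳 ⟶ S), IsSmoothProjectiveFamily f 8 →
        (∃ (N : ℕ) (ι : 𝒳 ⟶ projectiveSpace N ℂ ⊗ S),
            IsClosedImmersion ι.left ∧ ι ≫ snd (projectiveSpace N ℂ) S = f) →
        IrreducibleSpace S.left → AlgebraicGeometry.Smooth S.hom → IsQuasiProjectiveOver S →
        ∀ (W : complexBetti 𝒳 8),
          (∀ s : ComplexPoints S, IsRationalClass (complexBetti.map (fiberι f s) 8 W) ∧
            IsOfHodgeType 8 (fiberOver f s) 8 4 4 (complexBetti.map (fiberι f s) 8 W)) →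
          (∀ s : ComplexPoints S, ∃ (A' : AbelianVariety ℂ) (φ' : A' ⟶ A') (e' : A'.X ≅ fiberOver f s),
            A'.dim = 8 ∧ φ' ≫ φ' = -((7 : ℤ) • 𝟙 A') ∧
            complexBetti.map e'.hom 8 (complexBetti.map (fiberι f s) 8 W) ∈ weilClassesOf A' φ' 4 7) →
          ∀ s₀ : ComplexPoints S,
            (∃ (A : AbelianVariety ℂ) (φ : A ⟶ A) (e₀ : A.X ≅ fiberOver f s₀) (e : ProjectiveEmbedding A.X)
                (a : complexBetti (projectiveSpace e.n ℂ) 2),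
              A.dim = 8 ∧ φ ≫ φ = -((7 : ℤ) • 𝟙 A) ∧ IsRationalClass a ∧ a ≠ 0 ∧
              IsHyperbolicWeilType A φ 4
                ((7 : ℂ) • complexBetti.map e.ι 2 a + complexBetti.map φ.hom.hom.hom 2 (complexBetti.map e.ι 2 a)) ∧
              complexBetti.map e₀.hom 8 (complexBetti.map (fiberι f s₀) 8 W) ∈ weilClassesOf A φ 4 7) →
            (∃ s : ComplexPoints S, complexBetti.map (fiberι f s) 8 W ∈ algebraicClasses (fiberOver f s) 4) →
            complexBetti.map (fiberι f s₀) 8 W ∈ algebraicClasses (fiberOver f s₀) 4) :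
    Summit.HodgeConjecture.HodgeConjecture.Theses.HeckePrymWeil.HyperbolicEightfoldsSqrtMinus7 := by
  intro A φ hA hφ e a ha ha0 hhyp c hrat hH hW
  -- the zero class is algebraic
  by_cases h0 : c = 0
  · rw [h0]; exact Submodule.zero_mem _
  have hA' : A.dim = 2 * 4 := hA
  -- typing upgrade
  have hcW : c ∈ weilClassesOf A φ 4 7 := stub_upgrade 7 (by norm_num) (by norm_num) le_rfl 4 A φ hA' hφ hW
  -- the hyperbolic Weil family through `A`
  obtain ⟨𝒳, S, f, s₀, e', Y, Ψ, ε, hfam, hemb, hirr, hsm, hSqp, hYΨ, hsec, hreach⟩ :=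
    hHF 4 7 (by norm_num) (by norm_num) A φ e a hA' (by exact_mod_cast hφ) ha ha0
      (by exact_mod_cast hhyp)
  -- the flat Weil section through `c`
  obtain ⟨σ, hσc, hσ₀, hσfib⟩ := hsec c hcW
  have hpt : ∀ s, (σ s).pt = s := fun s ↦ by
    obtain ⟨x, hx, -, -⟩ := hσfib s
    rw [hx]
  -- the global class of the section (W-engine, landed unconditional)
  obtain ⟨W, hWσ⟩ :=
    Summit.HodgeConjecture.HodgeConjecture.Theorems.HyperbolicEightfoldsSqrtMinus7.TensorAnchor.stub_globalClassEngine
      f 8 8 hfam hemb hsm hSqp hirr σ hσc hpt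
  have hcls : ∀ (s : ComplexPoints S) (y : complexBetti (fiberOver f s) 8),
      σ s = ⟨s, y⟩ → complexBetti.map (fiberι f s) 8 W = y := by
    intro s y hy
    have h := (hWσ s).symm.trans hy
    simp only [globalSection, FiberClass.mk.injEq, heq_eq_eq, true_and] at h
    exact h
  have hW₀ : complexBetti.map (fiberι f s₀) 8 W = complexBetti.map e'.inv 8 c := hcls s₀ _ hσ₀
  -- rationality along the section (landed) and the fibrewise clauses of the fact
  have hrat₀ : IsRationalClass (σ s₀).cls := by rw [hσ₀]; exact hrat.map _
  have hratσ : ∀ s, IsRationalClass (σ s).cls :=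
    stub_rationalAlongSection f 8 8 hfam hsm hSqp hirr σ hσc hpt s₀ hrat₀
  have hfibre : ∀ s : ComplexPoints S, IsRationalClass (complexBetti.map (fiberι f s) 8 W) ∧
      IsOfHodgeType 8 (fiberOver f s) 8 4 4 (complexBetti.map (fiberι f s) 8 W) := by
    intro s
    obtain ⟨x, hx, hxH, -⟩ := hσfib s
    have h₁ := hratσ s
    rw [hx] at h₁
    rw [hcls s x hx]
    exact ⟨h₁, hxH⟩
  have hchart : ∀ s : ComplexPoints S, ∃ (A' : AbelianVariety ℂ) (φ' : A' ⟶ A') (e₁ : A'.X ≅ fiberOver f s),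
      A'.dim = 8 ∧ φ' ≫ φ' = -((7 : ℤ) • 𝟙 A') ∧
      complexBetti.map e₁.hom 8 (complexBetti.map (fiberι f s) 8 W) ∈ weilClassesOf A' φ' 4 7 := by
    intro s
    obtain ⟨x, hx, -, hxW⟩ := hσfib s
    obtain ⟨hYdim, hΨs⟩ := hYΨ s
    refine ⟨Y s, Ψ s, ε s, hYdim, by exact_mod_cast hΨs, ?_⟩
    rw [hcls s x hx]
    exact hxW
  -- the anchor, reached by a `K`-isogeny from a fibre `Y_s`
  obtain ⟨T, φT, eT, aT, hTdim, hφT, haT, haT0, hThyp, hTalg⟩ := hypAnchor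
  obtain ⟨s, u, v, m, hu, hm, huv, hv⟩ :=
    hreach T φT eT aT hTdim (by exact_mod_cast hφT) haT haT0 (by exact_mod_cast hThyp)
  obtain ⟨hYdim, hΨs⟩ := hYΨ s
  have hYalg : weilClassesOf (Y s) (Ψ s) 4 7 ≤ algebraicClasses (Y s).X 4 :=
    stub_isogenyTransfer 7 4 (Y s) T (Ψ s) φT hYdim hTdim hΨs u v m hm huv hu hv hTalg
  -- hence `W|_{𝒳_s}` is algebraic
  have halgs : complexBetti.map (fiberι f s) 8 W ∈ algebraicClasses (fiberOver f s) 4 := by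
    obtain ⟨x, hx, -, hxW⟩ := hσfib s
    rw [hcls s x hx]
    exact owf_isoTransport _ (Y s) (ε s) 4 x (hYalg hxW)
  -- transport to `s₀`, whose chart is `A` itself (hyperbolic)
  have hhyp₀ : ∃ (A₀ : AbelianVariety ℂ) (φ₀ : A₀ ⟶ A₀) (e₀ : A₀.X ≅ fiberOver f s₀) (e₁ : ProjectiveEmbedding A₀.X)
      (a₁ : complexBetti (projectiveSpace e₁.n ℂ) 2),
      A₀.dim = 8 ∧ φ₀ ≫ φ₀ = -((7 : ℤ) • 𝟙 A₀) ∧ IsRationalClass a₁ ∧ a₁ ≠ 0 ∧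
      IsHyperbolicWeilType A₀ φ₀ 4
        ((7 : ℂ) • complexBetti.map e₁.ι 2 a₁ + complexBetti.map φ₀.hom.hom.hom 2 (complexBetti.map e₁.ι 2 a₁)) ∧
      complexBetti.map e₀.hom 8 (complexBetti.map (fiberι f s₀) 8 W) ∈ weilClassesOf A₀ φ₀ 4 7 := by
    refine ⟨A, φ, e', e, a, hA, hφ, ha, ha0, hhyp, ?_⟩
    rw [hW₀, ← CategoryTheory.comp_apply, ← complexBetti.map_comp, Iso.hom_inv_id, complexBetti.map_id]
    exact hcW
  have halg₀ : complexBetti.map (fiberι f s₀) 8 W ∈ algebraicClasses (fiberOver f s₀) 4 :=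
    hHT f hfam hemb hirr hsm hSqp W hfibre hchart s₀ hhyp₀ ⟨s, halgs⟩
  -- return along `e' : A ≅ 𝒳_{s₀}`
  have key := mem_algebraicClasses_map_of_iso (p := 4) (hfam.isSmoothProjective s₀)
    (AbelianVariety.isSmoothProjective_holds (A := A)) e' halg₀
  rw [hW₀, ← CategoryTheory.comp_apply, ← complexBetti.map_comp, Iso.hom_inv_id, complexBetti.map_id] at key
  exact key

/-! ### The crux holds at the anchor (unconditional instance) -/

/-- **The crux holds AT THE ANCHOR, unconditionally**: for the explicit hyperbolic `√-7`-eightfold `(T, φ_T, e_T, a_T)`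
of `hypAnchor`, every class of the crux's typed Weil plane `Eig((𝟙+φ_T)^*, (1+i√7)⁸) ⊔ Eig((𝟙+φ_T)^*, (1-i√7)⁸)` is
algebraic (the typed plane lies in the strong one, `stub_upgrade`; the strong one is algebraic).  In particular the
hypotheses of the crux are jointly satisfiable and its conclusion is verified on the anchor family.
[cite: Deligne1982HodgeCycles, Lemma 4.5] [cite: vanGeemen1994HodgeAV, 5.2–5.4] -/
theorem hyperbolicEightfoldsSqrtMinus7_at_anchor :
    ∃ (T : AbelianVariety ℂ) (φT : T ⟶ T) (eT : ProjectiveEmbedding T.X)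
      (aT : complexBetti (projectiveSpace eT.n ℂ) 2),
      T.dim = 8 ∧ φT ≫ φT = -((7 : ℤ) • 𝟙 T) ∧ IsRationalClass aT ∧ aT ≠ 0 ∧
      IsHyperbolicWeilType T φT 4
        ((7 : ℂ) • complexBetti.map eT.ι 2 aT + complexBetti.map φT.hom.hom.hom 2 (complexBetti.map eT.ι 2 aT)) ∧
      ∀ c : complexBetti T.X 8,
        c ∈ Module.End.eigenspace (complexBetti.map (𝟙 T + φT).hom.hom.hom 8).hom
              ((1 + Complex.I * (Real.sqrt (7 : ℝ) : ℂ)) ^ 8) ⊔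
            Module.End.eigenspace (complexBetti.map (𝟙 T + φT).hom.hom.hom 8).hom
              ((1 - Complex.I * (Real.sqrt (7 : ℝ) : ℂ)) ^ 8) →
        c ∈ algebraicClasses T.X 4 := by
  obtain ⟨T, φT, eT, aT, hTdim, hφT, haT, haT0, hThyp, hTalg⟩ := hypAnchor
  refine ⟨T, φT, eT, aT, hTdim, hφT, haT, haT0, hThyp, fun c hW ↦ ?_⟩
  exact hTalg (stub_upgrade 7 (by norm_num) (by norm_num) le_rfl 4 T φT hTdim hφT hW)

/-! ### Tightness: the crux implies HT (so, modulo the named fact, crux ⟺ HT) -/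

/-- **The crux implies the hyperbolic Weil transport HT** — at the hyperbolic chart of `s₀` the crux applies
outright: `e₀^*(W|_{s₀})` is rational, of type `(4,4)`, and lies in the strong — hence the typed — Weil plane of the
hyperbolic `(A, φ, e, a)`; return by iso-invariance. Neither the family nor the algebraic fibre is used.
[cite: vanGeemen1994HodgeAV, 4.9] -/
theorem hypWeilTransport_of_hyperbolicEightfoldsSqrtMinus7 : Summit.HodgeConjecture.HodgeConjecture.Theses.HeckePrymWeil.HyperbolicEightfoldsSqrtMinus7 → ∀ ⦃𝒳 S : SchemeOver ℂ⦄ (f : 𝒳 ⟶ S), IsSmoothProjectiveFamily f 8 → (∃ (N : ℕ) (ι : 𝒳 ⟶ projectiveSpace N ℂ ⊗ S), IsClosedImmersion ι.left ∧ ι ≫ snd (projectiveSpace N ℂ) S = f) → IrreducibleSpace S.left → AlgebraicGeometry.Smooth S.hom → IsQuasiProjectiveOver S → ∀ (W : complexBetti 𝒳 8), (∀ s : ComplexPoints S, IsRationalClass (complexBetti.map (fiberι f s) 8 W) ∧ IsOfHodgeType 8 (fiberOver f s) 8 4 4 (complexBetti.map (fiberι f s) 8 W)) → (∀ s : ComplexPoints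 S, ∃ (A' : AbelianVariety ℂ) (φ' : A' ⟶ A') (e' : A'.X ≅ fiberOver f s), A'.dim = 8 ∧ φ' ≫ φ' = -((7 : ℤ) • 𝟙 A') ∧ complexBetti.map e'.hom 8 (complexBetti.map (fiberι f s) 8 W) ∈ weilClassesOf A' φ' 4 7) → ∀ s₀ : ComplexPoints S, (∃ (A : AbelianVariety ℂ) (φ : A ⟶ A) (e₀ : A.X ≅ fiberOver f s₀) (e : ProjectiveEmbedding A.X) (a : complexBetti (projectiveSpace e.n ℂ) 2), A.dim = 8 ∧ φ ≫ φ = -((7 : ℤ) • 𝟙 A) ∧ IsRationalClass a ∧ a ≠ 0 ∧ IsHyperbolicWeilType A φ 4 ((7 : ℂ) • complexBetti.map e.ι 2 a + complexBetti.map φ.hom.hom.hom 2 (complexBetti.map e.ι 2 a)) ∧ complexBetti.map e₀.hom 8 (complexBetti.map (fiberι f s₀) 8 W) ∈ weilClassesOf A φ 4 7) → (∃ s : ComplexPoints S, complexBetti.map (fiberι f s) 8 W ∈ algebraicClasses (fiberOver f s) 4) → complexBetti.map (fiberι f s₀) 8 W ∈ algebraicClasses (fiberOver f s₀) 4 :=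 by
  intro h 𝒳 S f hfam _ _ _ _ W hfibre _ s₀ ⟨A, φ, e₀, e, a, hA, hφ, ha, ha0, hhyp, hmem⟩ _
  obtain ⟨hrat, hH⟩ := hfibre s₀
  have hrat' : IsRationalClass (complexBetti.map e₀.hom 8 (complexBetti.map (fiberι f s₀) 8 W)) := hrat.map _
  have hH' : IsOfHodgeType 8 A.X 8 4 4 (complexBetti.map e₀.hom 8 (complexBetti.map (fiberι f s₀) 8 W)) :=
    hH.map_of_iso e₀
  have halg := h A φ hA hφ e a ha ha0 hhyp _ hrat' hH'
    (by exact_mod_cast weilClassesOf_le_eigenspace_sup_eigenspace φ 4 7 hmem)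
  exact owf_isoTransport _ A e₀ 4 _ halg

/-- **Given the named fact, the crux is EQUIVALENT to the hyperbolic Weil transport HT** (dimension 8,
`K = ℚ(√-7)`): HT is exactly the open content of the crux along this line (= Markman 2025 Thm 1.5.1 one
dimension up, on the hyperbolic component). [cite: Markman2025SecantWeil, Thm. 1.5.1 and §1.2] -/
theorem hyperbolicEightfoldsSqrtMinus7_iff_hypWeilTransport (hHF : weilFamily_hyperbolic_weilSystem_reach) :
    Summit.HodgeConjecture.HodgeConjecture.Theses.HeckePrymWeil.HyperbolicEightfoldsSqrtMinus7 ↔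
    ∀ ⦃𝒳 S : SchemeOver ℂ⦄ (f : 𝒳 ⟶ S), IsSmoothProjectiveFamily f 8 →
      (∃ (N : ℕ) (ι : 𝒳 ⟶ projectiveSpace N ℂ ⊗ S),
          IsClosedImmersion ι.left ∧ ι ≫ snd (projectiveSpace N ℂ) S = f) →
      IrreducibleSpace S.left → AlgebraicGeometry.Smooth S.hom → IsQuasiProjectiveOver S →
      ∀ (W : complexBetti 𝒳 8),
        (∀ s : ComplexPoints S, IsRationalClass (complexBetti.map (fiberι f s) 8 W) ∧
          IsOfHodgeType 8 (fiberOver f s) 8 4 4 (complexBetti.map (fiberι f s) 8 W)) →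
        (∀ s : ComplexPoints S, ∃ (A' : AbelianVariety ℂ) (φ' : A' ⟶ A') (e' : A'.X ≅ fiberOver f s),
          A'.dim = 8 ∧ φ' ≫ φ' = -((7 : ℤ) • 𝟙 A') ∧
          complexBetti.map e'.hom 8 (complexBetti.map (fiberι f s) 8 W) ∈ weilClassesOf A' φ' 4 7) →
        ∀ s₀ : ComplexPoints S,
          (∃ (A : AbelianVariety ℂ) (φ : A ⟶ A) (e₀ : A.X ≅ fiberOver f s₀) (e : ProjectiveEmbedding A.X)
              (a : complexBetti (projectiveSpace e.n ℂ) 2),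
            A.dim = 8 ∧ φ ≫ φ = -((7 : ℤ) • 𝟙 A) ∧ IsRationalClass a ∧ a ≠ 0 ∧
            IsHyperbolicWeilType A φ 4
              ((7 : ℂ) • complexBetti.map e.ι 2 a + complexBetti.map φ.hom.hom.hom 2 (complexBetti.map e.ι 2 a)) ∧
            complexBetti.map e₀.hom 8 (complexBetti.map (fiberι f s₀) 8 W) ∈ weilClassesOf A φ 4 7) →
          (∃ s : ComplexPoints S, complexBetti.map (fiberι f s) 8 W ∈ algebraicClasses (fiberOver f s) 4) →
          complexBetti.map (fiberι f s₀) 8 W ∈ algebraicClasses (fiberOver f s₀) 4 :=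
  ⟨hypWeilTransport_of_hyperbolicEightfoldsSqrtMinus7,
    hyperbolicEightfoldsSqrtMinus7_of_hypFamilyFact_of_hypWeilTransport hHF⟩

/-! ### Cross-links: HT from the route crux `WeilVariationalHodge` (stmt-HodgeConjecture-14497) -/

/-- **HT is implied by `WeilVariationalHodge (7,4)`** (forget the embedding, the Weil and the hyperbolic clauses).
[cite: Grothendieck1966, footnote 13] -/
theorem hypWeilTransport_of_weilVariationalHodge
    (hV : Summit.HodgeConjecture.HodgeConjecture.Theses.HeckePrymWeil.WeilVariationalHodge) :
    ∀ ⦃𝒳 S : SchemeOver ℂ⦄ (f : 𝒳 ⟶ S), IsSmoothProjectiveFamily f 8 →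
      (∃ (N : ℕ) (ι : 𝒳 ⟶ projectiveSpace N ℂ ⊗ S),
          IsClosedImmersion ι.left ∧ ι ≫ snd (projectiveSpace N ℂ) S = f) →
      IrreducibleSpace S.left → AlgebraicGeometry.Smooth S.hom → IsQuasiProjectiveOver S →
      ∀ (W : complexBetti 𝒳 8),
        (∀ s : ComplexPoints S, IsRationalClass (complexBetti.map (fiberι f s) 8 W) ∧
          IsOfHodgeType 8 (fiberOver f s) 8 4 4 (complexBetti.map (fiberι f s) 8 W)) →
        (∀ s : ComplexPoints S, ∃ (A' : AbelianVariety ℂ) (φ' : A' ⟶ A') (e' : A'.X ≅ fiberOver f s),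
          A'.dim = 8 ∧ φ' ≫ φ' = -((7 : ℤ) • 𝟙 A') ∧
          complexBetti.map e'.hom 8 (complexBetti.map (fiberι f s) 8 W) ∈ weilClassesOf A' φ' 4 7) →
        ∀ s₀ : ComplexPoints S,
          (∃ (A : AbelianVariety ℂ) (φ : A ⟶ A) (e₀ : A.X ≅ fiberOver f s₀) (e : ProjectiveEmbedding A.X)
              (a : complexBetti (projectiveSpace e.n ℂ) 2),
            A.dim = 8 ∧ φ ≫ φ = -((7 : ℤ) • 𝟙 A) ∧ IsRationalClass a ∧ a ≠ 0 ∧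
            IsHyperbolicWeilType A φ 4
              ((7 : ℂ) • complexBetti.map e.ι 2 a + complexBetti.map φ.hom.hom.hom 2 (complexBetti.map e.ι 2 a)) ∧
            complexBetti.map e₀.hom 8 (complexBetti.map (fiberι f s₀) 8 W) ∈ weilClassesOf A φ 4 7) →
          (∃ s : ComplexPoints S, complexBetti.map (fiberι f s) 8 W ∈ algebraicClasses (fiberOver f s) 4) →
          complexBetti.map (fiberι f s₀) 8 W ∈ algebraicClasses (fiberOver f s₀) 4 := by
  intro 𝒳 S f hfam _ hirr hsm _ W hfibre hchart s₀ _ halg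
  have hfib : ∀ s : ComplexPoints S, ∃ (A' : AbelianVariety ℂ) (φ' : A' ⟶ A'),
      A'.dim = 2 * 4 ∧ φ' ≫ φ' = -(((7 : ℕ) : ℤ) • 𝟙 A') ∧ Nonempty (A'.X ≅ fiberOver f s) := by
    intro s
    obtain ⟨A', φ', e', hA', hφ', -⟩ := hchart s
    exact ⟨A', φ', hA', by exact_mod_cast hφ', ⟨e'⟩⟩
  exact hV 7 (by norm_num) (by norm_num) le_rfl 4 (by norm_num) f hfam hirr hsm W hfibre hfib halg s₀

/-- **`HyperbolicEightfoldsSqrtMinus7` from the named fact `weilFamily_hyperbolic_weilSystem_reach` and the route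
crux `WeilVariationalHodge`** (stmt-HodgeConjecture-14497, OPEN) — CONDITIONAL on exactly these.
[cite: Deligne1982HodgeCycles, proof of Thm. 4.8 (pp. 47–52)] [cite: Grothendieck1966, footnote 13] -/
theorem hyperbolicEightfoldsSqrtMinus7_of_hypFamilyFact_of_weilVariationalHodge
    (hHF : weilFamily_hyperbolic_weilSystem_reach)
    (hV : Summit.HodgeConjecture.HodgeConjecture.Theses.HeckePrymWeil.WeilVariationalHodge) :
    Summit.HodgeConjecture.HodgeConjecture.Theses.HeckePrymWeil.HyperbolicEightfoldsSqrtMinus7 :=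
  hyperbolicEightfoldsSqrtMinus7_of_hypFamilyFact_of_hypWeilTransport hHF (hypWeilTransport_of_weilVariationalHodge hV)

end Summit.HodgeConjecture.HodgeConjecture.Theorems.HyperbolicEightfoldsSqrtMinus7.HyperbolicReach

end
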